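import Literature.NumberTheory.Automorphic.UnitaryRankOneBorelModulusIndex
import HarnessLib

/-!
# The standard parabolic subgroups `Q_c` of the quasi-split unitary group `U(σ, J₀)` and their Levi projections
# `Q_c → GL_c(K)`, `Q_c → U(σ, J₀^{(N-2c)})` (Bruhat–Tits 1972 (4.4.3); Cartier 1979 §IV (4.2); Rogawski 1990 §1.10)

Topic `NumberTheory/Automorphic`; namespace `Literature.NumberTheory.Automorphic.HermitianLattice` (lane `lit-hodgefound`, Track 2
foundations; seat `lit-hodgefound-p11`, generation 48, row g48-#2).  DEFINITIONS with bodies (index maps `midIndex`, `hiIndex`,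
`blockSum`, the label `blockLabel`, the parabolic `blockParabolic`, the extractions `loBlock`, `midBlock`, `loBlockGL`, `midBlockU`,
the block-diagonal matrices `blockDiagMatrix`, `dualBlock`, the lift `blockDiagLift` and the constructor `unitaryOfMatrix`) +
theorems; no named fact, no instance, no notation.

## The mathematics

`G = U(σ, J₀) ⊂ GL_N(K)`, `J₀ = antidiag(1, …, 1)`, `K₀ = G ∩ GL_N(𝒪)`.  For `0 ≤ c` with `2c ≤ N` the standard isotropic flag
member `⟨e_0, …, e_{c-1}⟩` has stabiliser the STANDARD PARABOLIC `Q_c` = the elements of `G` which are block upper triangular for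
the partition `[0, c) | [c, N - c) | [N - c, N)` of the indices (block label `0 | 1 | 2`, reversed by `rev`).  Its Levi quotient
is `GL_c(K) × U(σ, J₀^{(N-2c)})`: the diagonal blocks of `q ∈ Q_c` are `(A, g', A†)` with `A ∈ GL_c(K)`, `g' ∈ U(σ, J₀^{(N-2c)})`
and `A† = J σ(A⁻¹)ᵀ J` ([Rogawski1990] §1.10: `P = MN`, `M ≅ E^× × U(1)` for `U(3)`; [BruhatTits1972] (4.4.3) for the relative
root system `BC_n`/`C_n`).  `c = ⌊N/2⌋` is the SIEGEL parabolic (Levi `GL_n(K) (× U(1))`), `c = 1` the KLINGEN-type parabolic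
(Levi `K^× × U(σ, J₀^{(N-2)})`).  These are the parabolics along which the Satake transform descends (Cartier §IV (4.2):
`S = S_M ∘ (constant term along N_Q)`), used in the sequels for the Weyl-group invariance of the Satake transform of `G`.

## What is formalised

* §1 index bookkeeping for the three blocks: `blockLabel` (`_eq_zero_iff`, `_eq_one_iff`, `_eq_two_iff`, `_monotone`, `_rev`),
  `midIndex`, `hiIndex` (the first block is `Fin.castLE`), `rev` swaps the outer blocks and reverses each (`rev_castLE`,
  `rev_midIndex`, `rev_hiIndex`), the equivalence `blockSum : (Fin c ⊕ Fin (N-2c)) ⊕ Fin c ≃ Fin N` and the splitting of sums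
  `sum_eq_sum_blocks`, `sum_eq_sum_castLE_of`, `sum_eq_sum_midIndex_of`, `sum_eq_sum_hiIndex_of`.
* §2 `antidiagonal_over_apply`; **`unitaryOfMatrix`** (an `N × N` matrix with `σ(M)ᵀ J₀ M = J₀` IS an element of `U(σ, J₀)`, inverse
  `J₀ σ(M)ᵀ J₀`); **`blockParabolic σ N c ≤ U(σ, J₀)`** (block upper triangular elements), `mem_blockParabolic_iff`,
  `mem_blockParabolic_of_blockTriangular_id` (`B ≤ Q_c`), `apply_eq_zero_of_mem_blockParabolic`.
* §3 the Levi projections: `loBlock`/`midBlock` (`_apply`, `_one`) are multiplicative against block upper triangular matrices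
  (`loBlock_mul`, `midBlock_mul`), whence **`loBlockGL : Q_c →* GL_c(K)`** (`coe_loBlockGL`, `coe_loBlockGL_inv`) and, the middle
  block of a block-triangular unitary matrix being unitary (`midBlock_unitary`: only middle indices survive in
  `∑_k σ(q_{k a}) q_{rev k, b}`), **`midBlockU : Q_c →* U(σ, J₀^{(N-2c)})`** (`coe_midBlockU`).
* §4 `blockTriangular_loBlock`, `blockTriangular_midBlock`, `loBlock_apply_self`, `midBlock_apply_self` (upper triangular elements
  project to upper triangular elements with the corresponding diagonal); integrality: `v_loBlockGL_le_one` (`K₀ ∩ Q_c` maps to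
  integral matrices with integral inverses), `midBlockU_mem_unitaryInt` (and into `K₀` of the small group).
* §5 block-diagonal lifts: `blockDiagMatrix A B D` with its entry table (`_castLE_castLE`, `_midIndex_midIndex`, `_hiIndex_hiIndex`,
  `_apply_of_ne` and the row/column vanishing lemmas), `blockTriangular_blockDiagMatrix`, `loBlock_blockDiagMatrix`,
  `midBlock_blockDiagMatrix`; `dualBlock σ A' = J σ(A')ᵀ J`; **`blockDiagMatrix_unitary`** (`diag(A, g', J σ(A')ᵀ J)` satisfies the
  unitarity identity when `A' A = 1`, `g'` is unitary and `σ² = id`); **`blockDiagLift hσ hc A g' ∈ U(σ, J₀)`** with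
  `coe_blockDiagLift`, `blockDiagLift_mem_blockParabolic`, **`loBlockGL_blockDiagLift`** (`= A`), **`midBlockU_blockDiagLift`** (`= g'`),
  `blockDiagLift_apply_castLE_castLE`, **`blockDiagLift_mem_unitaryInt`** (integral data lift into `K₀`).

## References
* [BruhatTits1972] F. Bruhat, J. Tits, *Groupes réductifs sur un corps local I*, Publ. Math. IHÉS 41 (1972), (4.4.3).
* [CartierCorvallis1979] P. Cartier, *Representations of 𝔭-adic groups: a survey*, PSPM 33.1 (1979), §IV (4.2).
* [Rogawski1990] J. D. Rogawski, *Automorphic Representations of Unitary Groups in Three Variables*, Ann. of Math. Stud. 123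
  (1990), §1.9–§1.10.
* [GetzHahn2024] J. R. Getz, H. Hahn, *An Introduction to Automorphic Representations*, GTM 300 (2024), §7.5 (constant terms
  along parabolic subgroups).
-/

noncomputable section

open scoped Valued WithZero Matrix MatrixGroups

namespace Literature.NumberTheory.Automorphic.HermitianLattice

open Literature.NumberTheory.Automorphic

/-! ## §1 The three blocks `[0, c) | [c, N - c) | [N - c, N)` -/

section Blocks

variable {N c : ℕ}

/-- The block label `0 | 1 | 2` of an index for the partition `[0, c) | [c, N - c) | [N - c, N)`.
[cite: BruhatTits1972, (4.4.3)] -/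
def blockLabel (N c : ℕ) (i : Fin N) : ℕ := if (i : ℕ) < c then 0 else if (i : ℕ) + c < N then 1 else 2

/-- `blockLabel i = 0 ↔ i < c`. [cite: BruhatTits1972, (4.4.3)] -/
theorem blockLabel_eq_zero_iff (i : Fin N) : blockLabel N c i = 0 ↔ (i : ℕ) < c := by
  unfold blockLabel; split_ifs with h1 h2 <;> constructor <;> intro h <;> first | omega | exact h.elim

/-- `blockLabel i = 2 ↔ N ≤ i + c` (for `2c ≤ N`). [cite: BruhatTits1972, (4.4.3)] -/
theorem blockLabel_eq_two_iff (hc : 2 * c ≤ N) (i : Fin N) : blockLabel N c i = 2 ↔ N ≤ (i : ℕ) + c := by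
  have hi := i.isLt
  unfold blockLabel; split_ifs with h1 h2 <;> constructor <;> intro h <;> first | omega | exact h.elim

/-- `blockLabel i = 1 ↔ c ≤ i ∧ i + c < N`. [cite: BruhatTits1972, (4.4.3)] -/
theorem blockLabel_eq_one_iff (i : Fin N) : blockLabel N c i = 1 ↔ c ≤ (i : ℕ) ∧ (i : ℕ) + c < N := by
  unfold blockLabel; split_ifs with h1 h2 <;> constructor <;> intro h <;> first | omega | exact h.elim

/-- `blockLabel i ≤ 2`. [cite: BruhatTits1972, (4.4.3)] -/
theorem blockLabel_le_two (i : Fin N) : blockLabel N c i ≤ 2 := by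
  unfold blockLabel; split_ifs <;> decide

/-- The block label is monotone in the index. [cite: BruhatTits1972, (4.4.3)] -/
theorem blockLabel_monotone : Monotone (blockLabel N c) := by
  intro i j hij
  have hij' : (i : ℕ) ≤ j := hij
  unfold blockLabel; split_ifs <;> omega

/-- `rev` reverses the block labels: `blockLabel (rev i) = 2 - blockLabel i` (for `2c ≤ N`). [cite: BruhatTits1972, (4.4.3)] -/
theorem blockLabel_rev (hc : 2 * c ≤ N) (i : Fin N) : blockLabel N c (Fin.rev i) = 2 - blockLabel N c i := by
  have hi := i.isLt
  unfold blockLabel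
  simp only [Fin.val_rev]
  split_ifs <;> omega

/-- The middle block `[c, N - c)`: `j ↦ c + j`. [cite: BruhatTits1972, (4.4.3)] -/
def midIndex (hc : 2 * c ≤ N) (j : Fin (N - 2 * c)) : Fin N := ⟨c + j, by omega⟩

/-- The last block `[N - c, N)`: `j ↦ N - c + j`. [cite: BruhatTits1972, (4.4.3)] -/
def hiIndex (hc : 2 * c ≤ N) (j : Fin c) : Fin N := ⟨N - c + j, by omega⟩

/-- `(midIndex j : ℕ) = c + j`. [cite: BruhatTits1972, (4.4.3)] -/
@[simp] theorem coe_midIndex (hc : 2 * c ≤ N) (j : Fin (N - 2 * c)) : (midIndex hc j : ℕ) = c + j := rfl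

/-- `(hiIndex j : ℕ) = N - c + j`. [cite: BruhatTits1972, (4.4.3)] -/
@[simp] theorem coe_hiIndex (hc : 2 * c ≤ N) (j : Fin c) : (hiIndex hc j : ℕ) = N - c + j := rfl

/-- `c ≤ N` when `2c ≤ N`. [cite: BruhatTits1972, (4.4.3)] -/
theorem le_of_two_mul_le (hc : 2 * c ≤ N) : c ≤ N := by omega

/-- The first block has label `0`. [cite: BruhatTits1972, (4.4.3)] -/
@[simp] theorem blockLabel_castLE (hc : 2 * c ≤ N) (j : Fin c) : blockLabel N c (Fin.castLE (le_of_two_mul_le hc) j) = 0 := by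
  rw [blockLabel_eq_zero_iff]; exact j.isLt

/-- The middle block has label `1`. [cite: BruhatTits1972, (4.4.3)] -/
@[simp] theorem blockLabel_midIndex (hc : 2 * c ≤ N) (j : Fin (N - 2 * c)) : blockLabel N c (midIndex hc j) = 1 := by
  rw [blockLabel_eq_one_iff, coe_midIndex]; omega

/-- The last block has label `2`. [cite: BruhatTits1972, (4.4.3)] -/
@[simp] theorem blockLabel_hiIndex (hc : 2 * c ≤ N) (j : Fin c) : blockLabel N c (hiIndex hc j) = 2 := by
  rw [blockLabel_eq_two_iff hc, coe_hiIndex]; omega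

/-- `rev (castLE j) = hiIndex (rev j)`: `rev` carries the first block onto the last one, reversed. [cite: BruhatTits1972, (4.4.3)] -/
theorem rev_castLE (hc : 2 * c ≤ N) (j : Fin c) : Fin.rev (Fin.castLE (le_of_two_mul_le hc) j) = hiIndex hc (Fin.rev j) := by
  apply Fin.ext; simp only [Fin.val_rev, Fin.val_castLE, coe_hiIndex]; omega

/-- `rev (hiIndex j) = castLE (rev j)`. [cite: BruhatTits1972, (4.4.3)] -/
theorem rev_hiIndex (hc : 2 * c ≤ N) (j : Fin c) : Fin.rev (hiIndex hc j) = Fin.castLE (le_of_two_mul_le hc) (Fin.rev j) := by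
  apply Fin.ext; simp only [Fin.val_rev, Fin.val_castLE, coe_hiIndex]; omega

/-- `rev (midIndex j) = midIndex (rev j)`: `rev` preserves the middle block, acting as its own `rev`. [cite: BruhatTits1972, (4.4.3)] -/
theorem rev_midIndex (hc : 2 * c ≤ N) (j : Fin (N - 2 * c)) : Fin.rev (midIndex hc j) = midIndex hc (Fin.rev j) := by
  apply Fin.ext; simp only [Fin.val_rev, coe_midIndex]; omega

/-- `midIndex` is injective. [cite: BruhatTits1972, (4.4.3)] -/
theorem midIndex_injective (hc : 2 * c ≤ N) : Function.Injective (midIndex hc) := by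
  intro i j h; apply Fin.ext; have := congrArg Fin.val h; simp only [coe_midIndex] at this; omega

/-- `hiIndex` is injective. [cite: BruhatTits1972, (4.4.3)] -/
theorem hiIndex_injective (hc : 2 * c ≤ N) : Function.Injective (hiIndex hc) := by
  intro i j h; apply Fin.ext; have := congrArg Fin.val h; simp only [coe_hiIndex] at this; omega

/-- **The three blocks exhaust the indices**: `(Fin c ⊕ Fin (N - 2c)) ⊕ Fin c ≃ Fin N`, `inl (inl j) ↦ j`, `inl (inr j) ↦ c + j`,
`inr j ↦ N - c + j`. [cite: BruhatTits1972, (4.4.3)] -/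
def blockSum (hc : 2 * c ≤ N) : (Fin c ⊕ Fin (N - 2 * c)) ⊕ Fin c ≃ Fin N :=
  (finSumFinEquiv.sumCongr (Equiv.refl (Fin c))).trans (finSumFinEquiv.trans (finCongr (by omega)))

/-- `blockSum (inl (inl j)) = castLE j`. [cite: BruhatTits1972, (4.4.3)] -/
@[simp] theorem blockSum_inl_inl (hc : 2 * c ≤ N) (j : Fin c) :
    blockSum hc (Sum.inl (Sum.inl j)) = Fin.castLE (le_of_two_mul_le hc) j := by
  apply Fin.ext; simp [blockSum]

/-- `blockSum (inl (inr j)) = midIndex j`. [cite: BruhatTits1972, (4.4.3)] -/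
@[simp] theorem blockSum_inl_inr (hc : 2 * c ≤ N) (j : Fin (N - 2 * c)) :
    blockSum hc (Sum.inl (Sum.inr j)) = midIndex hc j := by
  apply Fin.ext; simp [blockSum]

/-- `blockSum (inr j) = hiIndex j`. [cite: BruhatTits1972, (4.4.3)] -/
@[simp] theorem blockSum_inr (hc : 2 * c ≤ N) (j : Fin c) : blockSum hc (Sum.inr j) = hiIndex hc j := by
  apply Fin.ext; simp [blockSum]; omega

/-- **Splitting a sum over the indices into the three blocks.** [cite: BruhatTits1972, (4.4.3)] -/
theorem sum_eq_sum_blocks {M : Type*} [AddCommMonoid M] (hc : 2 * c ≤ N) (f : Fin N → M) :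
    ∑ i, f i = ∑ j : Fin c, f (Fin.castLE (le_of_two_mul_le hc) j) + ∑ j : Fin (N - 2 * c), f (midIndex hc j) +
      ∑ j : Fin c, f (hiIndex hc j) := by
  rw [← Equiv.sum_comp (blockSum hc), Fintype.sum_sum_type, Fintype.sum_sum_type]
  simp only [blockSum_inl_inl, blockSum_inl_inr, blockSum_inr]

/-- A sum of a function vanishing off the first block is the sum over the first block. [cite: BruhatTits1972, (4.4.3)] -/
theorem sum_eq_sum_castLE_of {M : Type*} [AddCommMonoid M] (hc : 2 * c ≤ N) (f : Fin N → M)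
    (hf : ∀ i : Fin N, c ≤ (i : ℕ) → f i = 0) : ∑ i, f i = ∑ j : Fin c, f (Fin.castLE (le_of_two_mul_le hc) j) := by
  rw [sum_eq_sum_blocks hc, Finset.sum_eq_zero (s := (Finset.univ : Finset (Fin (N - 2 * c)))) fun j _ => hf _ (by simp),
    Finset.sum_eq_zero (s := (Finset.univ : Finset (Fin c))) fun j _ => hf (hiIndex hc j) (by simp; omega), add_zero, add_zero]

/-- A sum of a function vanishing off the middle block is the sum over the middle block. [cite: BruhatTits1972, (4.4.3)] -/
theorem sum_eq_sum_midIndex_of {M : Type*} [AddCommMonoid M] (hc : 2 * c ≤ N) (f : Fin N → M)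
    (hf₁ : ∀ i : Fin N, (i : ℕ) < c → f i = 0) (hf₂ : ∀ i : Fin N, N ≤ (i : ℕ) + c → f i = 0) :
    ∑ i, f i = ∑ j : Fin (N - 2 * c), f (midIndex hc j) := by
  rw [sum_eq_sum_blocks hc, Finset.sum_eq_zero (s := (Finset.univ : Finset (Fin c))) fun j _ => hf₁ (Fin.castLE _ j) (by simp),
    Finset.sum_eq_zero (s := (Finset.univ : Finset (Fin c))) fun j _ => hf₂ (hiIndex hc j) (by simp; omega), zero_add, add_zero]

/-- A sum of a function vanishing off the last block is the sum over the last block. [cite: BruhatTits1972, (4.4.3)] -/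
theorem sum_eq_sum_hiIndex_of {M : Type*} [AddCommMonoid M] (hc : 2 * c ≤ N) (f : Fin N → M)
    (hf : ∀ i : Fin N, (i : ℕ) + c < N → f i = 0) : ∑ i, f i = ∑ j : Fin c, f (hiIndex hc j) := by
  rw [sum_eq_sum_blocks hc, Finset.sum_eq_zero (s := (Finset.univ : Finset (Fin c))) fun j _ => hf (Fin.castLE _ j) (by simp; omega),
    Finset.sum_eq_zero (s := (Finset.univ : Finset (Fin (N - 2 * c)))) fun j _ => hf (midIndex hc j) (by simp; omega), zero_add,
    zero_add]

end Blocks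

/-! ## §2 The standard parabolic `Q_c ≤ U(σ, J₀)` and a constructor of unitary elements -/

section Parabolic

variable {K : Type*} [Field K] {σ : K →+* K} {N c : ℕ}

/-- Entries of `J₀ = antidiag(1, …, 1)` over `K`. [cite: Rogawski1990, §1.9] -/
theorem antidiagonal_over_apply (i j : Fin N) : (StdForm.antidiagonal N).over K i j = if j = Fin.rev i then (1 : K) else 0 := by
  simp only [StdForm.over, Matrix.map_apply, StdForm.antidiagonal_J_apply]
  split_ifs <;> simp

/-- **An `N × N` matrix `M` with `σ(M)ᵀ J₀ M = J₀` is an element of `U(σ, J₀)`** (it is invertible with inverse `J₀ σ(M)ᵀ J₀`).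
[cite: Rogawski1990, §1.9 p. 13] -/
def unitaryOfMatrix (M : Matrix (Fin N) (Fin N) K)
    (h : (M.map σ)ᵀ * (StdForm.antidiagonal N).over K * M = (StdForm.antidiagonal N).over K) :
    unitaryGroupOfForm σ ((StdForm.antidiagonal N).over K) :=
  have h2 : (StdForm.antidiagonal N).over K * (M.map σ)ᵀ * (StdForm.antidiagonal N).over K * M = 1 := by
    rw [Matrix.mul_assoc, Matrix.mul_assoc, ← Matrix.mul_assoc (M.map σ)ᵀ, h, StdForm.over_mul_over]
  ⟨⟨M, (StdForm.antidiagonal N).over K * (M.map σ)ᵀ * (StdForm.antidiagonal N).over K, mul_eq_one_comm.1 h2, h2⟩, h⟩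

/-- The matrix of `unitaryOfMatrix M h` is `M`. [cite: Rogawski1990, §1.9 p. 13] -/
@[simp] theorem coe_unitaryOfMatrix (M : Matrix (Fin N) (Fin N) K)
    (h : (M.map σ)ᵀ * (StdForm.antidiagonal N).over K * M = (StdForm.antidiagonal N).over K) :
    ((unitaryOfMatrix M h : GL (Fin N) K) : Matrix (Fin N) (Fin N) K) = M := rfl

variable (σ N c) in
/-- **The standard parabolic subgroup `Q_c ≤ U(σ, J₀)`**: the unitary elements which are block upper triangular for the blocks
`[0, c) | [c, N - c) | [N - c, N)` — the stabiliser of the isotropic subspace `⟨e_0, …, e_{c-1}⟩` of the standard flag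
(`c = ⌊N/2⌋`: the Siegel parabolic; `c = 1`: the stabiliser of the isotropic line `⟨e_0⟩`). [cite: BruhatTits1972, (4.4.3)]
[cite: Rogawski1990, §1.10] -/
def blockParabolic : Subgroup (unitaryGroupOfForm σ ((StdForm.antidiagonal N).over K)) where
  carrier := {g | ((g : GL (Fin N) K) : Matrix (Fin N) (Fin N) K).BlockTriangular (blockLabel N c)}
  one_mem' := by
    change (((1 : unitaryGroupOfForm σ ((StdForm.antidiagonal N).over K)) : GL (Fin N) K) : Matrix (Fin N) (Fin N) K).BlockTriangular _
    rw [OneMemClass.coe_one, Units.val_one]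
    exact Matrix.blockTriangular_one
  mul_mem' {g h} hg hh := by
    change (((g * h : unitaryGroupOfForm σ ((StdForm.antidiagonal N).over K)) : GL (Fin N) K) : Matrix (Fin N) (Fin N) K).BlockTriangular _
    rw [Subgroup.coe_mul, Units.val_mul]
    exact hg.mul hh
  inv_mem' {g} hg := by
    change (((g⁻¹ : unitaryGroupOfForm σ ((StdForm.antidiagonal N).over K)) : GL (Fin N) K) : Matrix (Fin N) (Fin N) K).BlockTriangular _
    rw [Subgroup.coe_inv, Matrix.coe_units_inv]
    letI := (g : GL (Fin N) K).invertible
    exact Matrix.blockTriangular_inv_of_blockTriangular hg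

/-- Membership in `Q_c`: the matrix is block upper triangular. [cite: BruhatTits1972, (4.4.3)] -/
theorem mem_blockParabolic_iff {g : unitaryGroupOfForm σ ((StdForm.antidiagonal N).over K)} :
    g ∈ blockParabolic σ N c ↔ ((g : GL (Fin N) K) : Matrix (Fin N) (Fin N) K).BlockTriangular (blockLabel N c) :=
  Iff.rfl

/-- Upper triangular elements lie in `Q_c` (`Q_c ⊇ B`). [cite: BruhatTits1972, (4.4.3)] -/
theorem mem_blockParabolic_of_blockTriangular_id {g : unitaryGroupOfForm σ ((StdForm.antidiagonal N).over K)}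
    (hg : ((g : GL (Fin N) K) : Matrix (Fin N) (Fin N) K).BlockTriangular id) : g ∈ blockParabolic σ N c :=
  fun _ _ hij => hg (lt_of_not_ge fun h => (blockLabel_monotone h).not_gt hij)

/-- An element of `Q_c` has zero entries below the diagonal blocks. [cite: BruhatTits1972, (4.4.3)] -/
theorem apply_eq_zero_of_mem_blockParabolic {g : unitaryGroupOfForm σ ((StdForm.antidiagonal N).over K)}
    (hg : g ∈ blockParabolic σ N c) {i j : Fin N} (hij : blockLabel N c j < blockLabel N c i) :
    ((g : GL (Fin N) K) : Matrix (Fin N) (Fin N) K) i j = 0 :=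
  hg hij

end Parabolic

/-! ## §3 The Levi projections `Q_c → GL_c(K)` and `Q_c → U(σ, J₀^{(N-2c)})` -/

section Levi

variable {K : Type*} [Field K] {σ : K →+* K} {N c : ℕ}

/-- The first diagonal block `M|_{[0,c) × [0,c)}`. [cite: Rogawski1990, §1.10] -/
def loBlock (hc : 2 * c ≤ N) (M : Matrix (Fin N) (Fin N) K) : Matrix (Fin c) (Fin c) K :=
  M.submatrix (Fin.castLE (le_of_two_mul_le hc)) (Fin.castLE (le_of_two_mul_le hc))

/-- The middle diagonal block `M|_{[c,N-c) × [c,N-c)}`. [cite: Rogawski1990, §1.10] -/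
def midBlock (hc : 2 * c ≤ N) (M : Matrix (Fin N) (Fin N) K) : Matrix (Fin (N - 2 * c)) (Fin (N - 2 * c)) K :=
  M.submatrix (midIndex hc) (midIndex hc)

omit [Field K] in
/-- Entries of `loBlock`. [cite: Rogawski1990, §1.10] -/
@[simp] theorem loBlock_apply (hc : 2 * c ≤ N) (M : Matrix (Fin N) (Fin N) K) (i j : Fin c) :
    loBlock hc M i j = M (Fin.castLE (le_of_two_mul_le hc) i) (Fin.castLE (le_of_two_mul_le hc) j) := rfl

omit [Field K] in
/-- Entries of `midBlock`. [cite: Rogawski1990, §1.10] -/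
@[simp] theorem midBlock_apply (hc : 2 * c ≤ N) (M : Matrix (Fin N) (Fin N) K) (i j : Fin (N - 2 * c)) :
    midBlock hc M i j = M (midIndex hc i) (midIndex hc j) := rfl

/-- `loBlock 1 = 1`. [cite: Rogawski1990, §1.10] -/
theorem loBlock_one (hc : 2 * c ≤ N) : loBlock hc (1 : Matrix (Fin N) (Fin N) K) = 1 := by
  ext i j
  simp only [loBlock_apply, Matrix.one_apply, (Fin.castLE_injective _).eq_iff]

/-- `midBlock 1 = 1`. [cite: Rogawski1990, §1.10] -/
theorem midBlock_one (hc : 2 * c ≤ N) : midBlock hc (1 : Matrix (Fin N) (Fin N) K) = 1 := by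
  ext i j
  simp only [midBlock_apply, Matrix.one_apply, (midIndex_injective hc).eq_iff]

/-- **`loBlock` is multiplicative against block upper triangular matrices**: `loBlock (M M') = loBlock M · loBlock M'` whenever
`M'` is block upper triangular (its first block-column vanishes below the first block). [cite: CartierCorvallis1979, §IV (4.2)] -/
theorem loBlock_mul (hc : 2 * c ≤ N) (M : Matrix (Fin N) (Fin N) K) {M' : Matrix (Fin N) (Fin N) K}
    (hM' : M'.BlockTriangular (blockLabel N c)) : loBlock hc (M * M') = loBlock hc M * loBlock hc M' := by
  ext i j
  rw [loBlock_apply, Matrix.mul_apply, Matrix.mul_apply]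
  rw [sum_eq_sum_castLE_of hc _ fun k hk => ?_]
  · rfl
  · rw [hM' (show blockLabel N c (Fin.castLE _ j) < blockLabel N c k by
      rw [blockLabel_castLE hc]; exact Nat.pos_of_ne_zero fun h => by rw [blockLabel_eq_zero_iff] at h; omega), mul_zero]

/-- **`midBlock` is multiplicative on block upper triangular matrices.** [cite: CartierCorvallis1979, §IV (4.2)] -/
theorem midBlock_mul (hc : 2 * c ≤ N) {M M' : Matrix (Fin N) (Fin N) K} (hM : M.BlockTriangular (blockLabel N c))
    (hM' : M'.BlockTriangular (blockLabel N c)) : midBlock hc (M * M') = midBlock hc M * midBlock hc M' := by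
  ext i j
  rw [midBlock_apply, Matrix.mul_apply, Matrix.mul_apply]
  rw [sum_eq_sum_midIndex_of hc _ (fun k hk => ?_) fun k hk => ?_]
  · rfl
  · rw [hM (show blockLabel N c k < blockLabel N c (midIndex hc i) by
      rw [blockLabel_midIndex, (blockLabel_eq_zero_iff k).2 hk]; exact Nat.zero_lt_one), zero_mul]
  · rw [hM' (show blockLabel N c (midIndex hc j) < blockLabel N c k by
      rw [blockLabel_midIndex, (blockLabel_eq_two_iff hc k).2 hk]; exact Nat.lt_succ_self 1), mul_zero]

/-- **The Levi projection `Q_c → GL_c(K)`** onto the first diagonal block. [cite: Rogawski1990, §1.10] [cite: BruhatTits1972, (4.4.3)] -/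
def loBlockGL (hc : 2 * c ≤ N) : blockParabolic σ N c →* GL (Fin c) K where
  toFun q := ⟨loBlock hc ((q.1 : GL (Fin N) K) : Matrix (Fin N) (Fin N) K),
    loBlock hc ((((q⁻¹ : blockParabolic σ N c) : unitaryGroupOfForm σ ((StdForm.antidiagonal N).over K)) : GL (Fin N) K) :
      Matrix (Fin N) (Fin N) K),
    by rw [← loBlock_mul hc _ (q⁻¹).2, Subgroup.coe_inv, Subgroup.coe_inv, ← Units.val_mul, mul_inv_cancel, Units.val_one,
      loBlock_one],
    by rw [← loBlock_mul hc _ q.2, Subgroup.coe_inv, Subgroup.coe_inv, ← Units.val_mul, inv_mul_cancel, Units.val_one,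
      loBlock_one]⟩
  map_one' := Units.ext (by simp only [OneMemClass.coe_one, Units.val_one]; exact loBlock_one hc)
  map_mul' q q' := Units.ext (by
    simp only [Subgroup.coe_mul, Units.val_mul]
    exact loBlock_mul hc _ q'.2)

/-- The matrix of `loBlockGL q` is the first block of `q`. [cite: Rogawski1990, §1.10] -/
@[simp] theorem coe_loBlockGL (hc : 2 * c ≤ N) (q : blockParabolic σ N c) :
    ((loBlockGL hc q : GL (Fin c) K) : Matrix (Fin c) (Fin c) K) = loBlock hc ((q.1 : GL (Fin N) K) : Matrix (Fin N) (Fin N) K) :=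
  rfl

/-- The matrix of `(loBlockGL q)⁻¹` is the first block of `q⁻¹`. [cite: Rogawski1990, §1.10] -/
theorem coe_loBlockGL_inv (hc : 2 * c ≤ N) (q : blockParabolic σ N c) :
    (((loBlockGL hc q)⁻¹ : GL (Fin c) K) : Matrix (Fin c) (Fin c) K) =
      loBlock hc ((((q.1 : unitaryGroupOfForm σ ((StdForm.antidiagonal N).over K)) : GL (Fin N) K)⁻¹ : GL (Fin N) K) :
        Matrix (Fin N) (Fin N) K) := by
  rw [← map_inv]
  change loBlock hc ((((q⁻¹ : blockParabolic σ N c) : unitaryGroupOfForm σ ((StdForm.antidiagonal N).over K)) : GL (Fin N) K) :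
      Matrix (Fin N) (Fin N) K) = _
  rw [Subgroup.coe_inv, Subgroup.coe_inv]

/-- **The middle block of a block upper triangular unitary matrix is unitary** for the small antidiagonal form: in
`∑_k σ(q_{k a}) q_{rev k, b} = δ_{b, rev a}` with `a, b` in the middle block only middle `k` contribute. [cite: Rogawski1990, §1.10]
[cite: BruhatTits1972, (4.4.3)] -/
theorem midBlock_unitary (hc : 2 * c ≤ N) (q : blockParabolic σ N c) :
    ((midBlock hc ((q.1 : GL (Fin N) K) : Matrix (Fin N) (Fin N) K)).map σ)ᵀ * (StdForm.antidiagonal (N - 2 * c)).over K *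
        midBlock hc ((q.1 : GL (Fin N) K) : Matrix (Fin N) (Fin N) K) = (StdForm.antidiagonal (N - 2 * c)).over K := by
  ext a b
  rw [map_transpose_mul_antidiagonal_mul_apply, antidiagonal_over_apply]
  have h := sum_map_mul_rev_apply_eq q.1 (midIndex hc a) (midIndex hc b)
  rw [sum_eq_sum_midIndex_of hc _ (fun k hk => ?_) fun k hk => ?_] at h
  · simp only [rev_midIndex, (midIndex_injective hc).eq_iff] at h
    simpa only [midBlock_apply] using h
  · rw [apply_eq_zero_of_mem_blockParabolic q.2 (i := Fin.rev k) (j := midIndex hc b)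
      (by rw [blockLabel_midIndex, blockLabel_rev hc, (blockLabel_eq_zero_iff k).2 hk]; norm_num), mul_zero]
  · rw [apply_eq_zero_of_mem_blockParabolic q.2 (i := k) (j := midIndex hc a)
      (by rw [blockLabel_midIndex, (blockLabel_eq_two_iff hc k).2 hk]; norm_num), map_zero, zero_mul]

/-- **The Levi projection `Q_c → U(σ, J₀^{(N-2c)})`** onto the middle diagonal block. [cite: Rogawski1990, §1.10]
[cite: BruhatTits1972, (4.4.3)] -/
def midBlockU (hc : 2 * c ≤ N) :
    blockParabolic σ N c →* unitaryGroupOfForm σ ((StdForm.antidiagonal (N - 2 * c)).over K) where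
  toFun q := unitaryOfMatrix (midBlock hc ((q.1 : GL (Fin N) K) : Matrix (Fin N) (Fin N) K)) (midBlock_unitary hc q)
  map_one' := Subtype.ext (Units.ext (by
    change midBlock hc ((((1 : blockParabolic σ N c) : unitaryGroupOfForm σ ((StdForm.antidiagonal N).over K)) :
      GL (Fin N) K) : Matrix (Fin N) (Fin N) K) = (((1 : unitaryGroupOfForm σ ((StdForm.antidiagonal (N - 2 * c)).over K)) :
        GL (Fin (N - 2 * c)) K) : Matrix (Fin (N - 2 * c)) (Fin (N - 2 * c)) K)
    rw [OneMemClass.coe_one, OneMemClass.coe_one, Units.val_one, OneMemClass.coe_one, Units.val_one]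
    exact midBlock_one hc))
  map_mul' q q' := Subtype.ext (Units.ext (by
    change midBlock hc ((((q * q' : blockParabolic σ N c) : unitaryGroupOfForm σ ((StdForm.antidiagonal N).over K)) :
      GL (Fin N) K) : Matrix (Fin N) (Fin N) K) =
      midBlock hc ((q.1 : GL (Fin N) K) : Matrix (Fin N) (Fin N) K) * midBlock hc ((q'.1 : GL (Fin N) K) : Matrix (Fin N) (Fin N) K)
    rw [Subgroup.coe_mul, Subgroup.coe_mul, Units.val_mul]
    exact midBlock_mul hc q.2 q'.2))

/-- The matrix of `midBlockU q` is the middle block of `q`. [cite: Rogawski1990, §1.10] -/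
@[simp] theorem coe_midBlockU (hc : 2 * c ≤ N) (q : blockParabolic σ N c) :
    ((midBlockU hc q : GL (Fin (N - 2 * c)) K) : Matrix (Fin (N - 2 * c)) (Fin (N - 2 * c)) K) =
      midBlock hc ((q.1 : GL (Fin N) K) : Matrix (Fin N) (Fin N) K) := rfl

/-! ## §4 Upper triangular elements; integrality -/

/-- The first block of an upper triangular matrix is upper triangular. [cite: BruhatTits1972, (4.4.3)] -/
theorem blockTriangular_loBlock (hc : 2 * c ≤ N) {M : Matrix (Fin N) (Fin N) K} (hM : M.BlockTriangular id) :
    (loBlock hc M).BlockTriangular id := fun i j hij =>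
  hM (show (id (Fin.castLE _ j) : Fin N) < id (Fin.castLE _ i) from Fin.lt_def.2 (by simpa using Fin.lt_def.1 hij))

/-- The middle block of an upper triangular matrix is upper triangular. [cite: BruhatTits1972, (4.4.3)] -/
theorem blockTriangular_midBlock (hc : 2 * c ≤ N) {M : Matrix (Fin N) (Fin N) K} (hM : M.BlockTriangular id) :
    (midBlock hc M).BlockTriangular id := fun i j hij =>
  hM (show (id (midIndex hc j) : Fin N) < id (midIndex hc i) from Fin.lt_def.2 (by simpa using Fin.lt_def.1 hij))

omit [Field K] in
/-- Diagonal entries of the first block. [cite: BruhatTits1972, (4.4.3)] -/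
theorem loBlock_apply_self (hc : 2 * c ≤ N) (M : Matrix (Fin N) (Fin N) K) (j : Fin c) :
    loBlock hc M j j = M (Fin.castLE (le_of_two_mul_le hc) j) (Fin.castLE (le_of_two_mul_le hc) j) := rfl

omit [Field K] in
/-- Diagonal entries of the middle block. [cite: BruhatTits1972, (4.4.3)] -/
theorem midBlock_apply_self (hc : 2 * c ≤ N) (M : Matrix (Fin N) (Fin N) K) (j : Fin (N - 2 * c)) :
    midBlock hc M j j = M (midIndex hc j) (midIndex hc j) := rfl

variable [Valued K ℤᵐ⁰]

/-- **`K₀ ∩ Q_c` projects to integral matrices with integral inverses** in `GL_c(K)`. [cite: BruhatTits1972, (4.4.3)]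
[cite: CartierCorvallis1979, §IV.1] -/
theorem v_loBlockGL_le_one (hc : 2 * c ≤ N) {q : blockParabolic σ N c}
    (hq : (q.1 : unitaryGroupOfForm σ ((StdForm.antidiagonal N).over K)) ∈ unitaryInt σ ((StdForm.antidiagonal N).over K)) :
    (∀ i j, Valued.v (((loBlockGL hc q : GL (Fin c) K) : Matrix (Fin c) (Fin c) K) i j) ≤ 1) ∧
      ∀ i j, Valued.v ((((loBlockGL hc q)⁻¹ : GL (Fin c) K) : Matrix (Fin c) (Fin c) K) i j) ≤ 1 := by
  rw [mem_unitaryInt_iff] at hq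
  refine ⟨fun i j => ?_, fun i j => ?_⟩
  · rw [coe_loBlockGL, loBlock_apply]; exact hq.1 _ _
  · rw [coe_loBlockGL_inv, loBlock_apply]; exact hq.2 _ _

/-- **`K₀ ∩ Q_c` projects into `K₀` of the small unitary group.** [cite: BruhatTits1972, (4.4.3)] [cite: CartierCorvallis1979, §IV.1] -/
theorem midBlockU_mem_unitaryInt (hvσ : ∀ x, Valued.v (σ x) = Valued.v x) (hc : 2 * c ≤ N) {q : blockParabolic σ N c}
    (hq : (q.1 : unitaryGroupOfForm σ ((StdForm.antidiagonal N).over K)) ∈ unitaryInt σ ((StdForm.antidiagonal N).over K)) :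
    midBlockU hc q ∈ unitaryInt σ ((StdForm.antidiagonal (N - 2 * c)).over K) := by
  rw [mem_unitaryInt_iff_forall_v_le_one hvσ]
  intro i j
  rw [coe_midBlockU, midBlock_apply]
  exact (mem_unitaryInt_iff.1 hq).1 _ _

end Levi

/-! ## §5 Block-diagonal lifts `diag(A, g', D)` -/

section Lift

variable {K : Type*} [Field K] {σ : K →+* K} {N c : ℕ}

/-- The block-diagonal `N × N` matrix `diag(A, B, D)` for the blocks `[0, c) | [c, N - c) | [N - c, N)`.
[cite: Rogawski1990, §1.10] -/
def blockDiagMatrix (hc : 2 * c ≤ N) (A : Matrix (Fin c) (Fin c) K) (B : Matrix (Fin (N - 2 * c)) (Fin (N - 2 * c)) K)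
    (D : Matrix (Fin c) (Fin c) K) : Matrix (Fin N) (Fin N) K :=
  Matrix.of fun i j =>
    if hi : (i : ℕ) < c then (if hj : (j : ℕ) < c then A ⟨i, hi⟩ ⟨j, hj⟩ else 0)
    else if hi' : (i : ℕ) + c < N then
      (if hj : c ≤ (j : ℕ) ∧ (j : ℕ) + c < N then B ⟨i - c, by omega⟩ ⟨j - c, by omega⟩ else 0)
    else (if hj : N ≤ (j : ℕ) + c then D ⟨i + c - N, by omega⟩ ⟨j + c - N, by have := j.isLt; omega⟩ else 0)

/-- `diag(A, B, D)` on the first block. [cite: Rogawski1990, §1.10] -/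
@[simp] theorem blockDiagMatrix_castLE_castLE (hc : 2 * c ≤ N) (A : Matrix (Fin c) (Fin c) K)
    (B : Matrix (Fin (N - 2 * c)) (Fin (N - 2 * c)) K) (D : Matrix (Fin c) (Fin c) K) (i j : Fin c) :
    blockDiagMatrix hc A B D (Fin.castLE (le_of_two_mul_le hc) i) (Fin.castLE (le_of_two_mul_le hc) j) = A i j := by
  simp [blockDiagMatrix]

/-- `diag(A, B, D)` on the middle block. [cite: Rogawski1990, §1.10] -/
@[simp] theorem blockDiagMatrix_midIndex_midIndex (hc : 2 * c ≤ N) (A : Matrix (Fin c) (Fin c) K)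
    (B : Matrix (Fin (N - 2 * c)) (Fin (N - 2 * c)) K) (D : Matrix (Fin c) (Fin c) K) (i j : Fin (N - 2 * c)) :
    blockDiagMatrix hc A B D (midIndex hc i) (midIndex hc j) = B i j := by
  have h1 : ¬ ((midIndex hc i : ℕ) < c) := by simp
  have h2 : (midIndex hc i : ℕ) + c < N := by simp; omega
  have h3 : c ≤ (midIndex hc j : ℕ) ∧ (midIndex hc j : ℕ) + c < N := by simp; omega
  rw [blockDiagMatrix, Matrix.of_apply, dif_neg h1, dif_pos h2, dif_pos h3]
  congr 1 <;> apply Fin.ext <;> simp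

/-- `diag(A, B, D)` on the last block. [cite: Rogawski1990, §1.10] -/
@[simp] theorem blockDiagMatrix_hiIndex_hiIndex (hc : 2 * c ≤ N) (A : Matrix (Fin c) (Fin c) K)
    (B : Matrix (Fin (N - 2 * c)) (Fin (N - 2 * c)) K) (D : Matrix (Fin c) (Fin c) K) (i j : Fin c) :
    blockDiagMatrix hc A B D (hiIndex hc i) (hiIndex hc j) = D i j := by
  have h1 : ¬ ((hiIndex hc i : ℕ) < c) := by simp; omega
  have h2 : ¬ ((hiIndex hc i : ℕ) + c < N) := by simp; omega
  have h3 : N ≤ (hiIndex hc j : ℕ) + c := by simp; omega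
  have hi := i.isLt
  have hj := j.isLt
  rw [blockDiagMatrix, Matrix.of_apply, dif_neg h1, dif_neg h2, dif_pos h3]
  congr 1 <;> apply Fin.ext <;> simp <;> omega

/-- `diag(A, B, D)` vanishes off the diagonal blocks. [cite: Rogawski1990, §1.10] -/
theorem blockDiagMatrix_apply_of_ne (hc : 2 * c ≤ N) (A : Matrix (Fin c) (Fin c) K)
    (B : Matrix (Fin (N - 2 * c)) (Fin (N - 2 * c)) K) (D : Matrix (Fin c) (Fin c) K) {i j : Fin N}
    (hij : blockLabel N c i ≠ blockLabel N c j) : blockDiagMatrix hc A B D i j = 0 := by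
  unfold blockLabel at hij
  rw [blockDiagMatrix, Matrix.of_apply]
  split_ifs at hij ⊢ with h1 h2 h3 h4 h5 <;> first | rfl | omega

/-- `diag(A, B, D)` is block upper triangular (indeed block diagonal). [cite: Rogawski1990, §1.10] -/
theorem blockTriangular_blockDiagMatrix (hc : 2 * c ≤ N) (A : Matrix (Fin c) (Fin c) K)
    (B : Matrix (Fin (N - 2 * c)) (Fin (N - 2 * c)) K) (D : Matrix (Fin c) (Fin c) K) :
    (blockDiagMatrix hc A B D).BlockTriangular (blockLabel N c) := fun _ _ hij =>
  blockDiagMatrix_apply_of_ne hc A B D hij.ne'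

/-- Row `castLE i` of `diag(A, B, D)` vanishes outside the first block. [cite: Rogawski1990, §1.10] -/
theorem blockDiagMatrix_castLE_apply_of_le (hc : 2 * c ≤ N) (A : Matrix (Fin c) (Fin c) K)
    (B : Matrix (Fin (N - 2 * c)) (Fin (N - 2 * c)) K) (D : Matrix (Fin c) (Fin c) K) (i : Fin c) {k : Fin N}
    (hk : c ≤ (k : ℕ)) : blockDiagMatrix hc A B D (Fin.castLE (le_of_two_mul_le hc) i) k = 0 :=
  blockDiagMatrix_apply_of_ne hc A B D (by
    rw [blockLabel_castLE hc]; exact fun h => by have := (blockLabel_eq_zero_iff k).1 h.symm; omega)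

/-- Column `castLE j` of `diag(A, B, D)` vanishes outside the first block. [cite: Rogawski1990, §1.10] -/
theorem blockDiagMatrix_apply_castLE_of_le (hc : 2 * c ≤ N) (A : Matrix (Fin c) (Fin c) K)
    (B : Matrix (Fin (N - 2 * c)) (Fin (N - 2 * c)) K) (D : Matrix (Fin c) (Fin c) K) (j : Fin c) {k : Fin N}
    (hk : c ≤ (k : ℕ)) : blockDiagMatrix hc A B D k (Fin.castLE (le_of_two_mul_le hc) j) = 0 :=
  blockDiagMatrix_apply_of_ne hc A B D (by
    rw [blockLabel_castLE hc]; exact fun h => by have := (blockLabel_eq_zero_iff k).1 h; omega)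

/-- Row `midIndex i` of `diag(A, B, D)` vanishes outside the middle block. [cite: Rogawski1990, §1.10] -/
theorem blockDiagMatrix_midIndex_apply_of (hc : 2 * c ≤ N) (A : Matrix (Fin c) (Fin c) K)
    (B : Matrix (Fin (N - 2 * c)) (Fin (N - 2 * c)) K) (D : Matrix (Fin c) (Fin c) K) (i : Fin (N - 2 * c)) {k : Fin N}
    (hk : (k : ℕ) < c ∨ N ≤ (k : ℕ) + c) : blockDiagMatrix hc A B D (midIndex hc i) k = 0 :=
  blockDiagMatrix_apply_of_ne hc A B D (by
    rw [blockLabel_midIndex]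
    rcases hk with hk | hk
    · rw [(blockLabel_eq_zero_iff k).2 hk]; exact one_ne_zero
    · rw [(blockLabel_eq_two_iff hc k).2 hk]; decide)

/-- Column `midIndex j` of `diag(A, B, D)` vanishes outside the middle block. [cite: Rogawski1990, §1.10] -/
theorem blockDiagMatrix_apply_midIndex_of (hc : 2 * c ≤ N) (A : Matrix (Fin c) (Fin c) K)
    (B : Matrix (Fin (N - 2 * c)) (Fin (N - 2 * c)) K) (D : Matrix (Fin c) (Fin c) K) (j : Fin (N - 2 * c)) {k : Fin N}
    (hk : (k : ℕ) < c ∨ N ≤ (k : ℕ) + c) : blockDiagMatrix hc A B D k (midIndex hc j) = 0 :=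
  blockDiagMatrix_apply_of_ne hc A B D (by
    rw [blockLabel_midIndex]
    rcases hk with hk | hk
    · rw [(blockLabel_eq_zero_iff k).2 hk]; exact zero_ne_one
    · rw [(blockLabel_eq_two_iff hc k).2 hk]; decide)

/-- Row `hiIndex i` of `diag(A, B, D)` vanishes outside the last block. [cite: Rogawski1990, §1.10] -/
theorem blockDiagMatrix_hiIndex_apply_of_lt (hc : 2 * c ≤ N) (A : Matrix (Fin c) (Fin c) K)
    (B : Matrix (Fin (N - 2 * c)) (Fin (N - 2 * c)) K) (D : Matrix (Fin c) (Fin c) K) (i : Fin c) {k : Fin N}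
    (hk : (k : ℕ) + c < N) : blockDiagMatrix hc A B D (hiIndex hc i) k = 0 :=
  blockDiagMatrix_apply_of_ne hc A B D (by
    rw [blockLabel_hiIndex hc]; exact fun h => by have := (blockLabel_eq_two_iff hc k).1 h.symm; omega)

/-- Column `hiIndex j` of `diag(A, B, D)` vanishes outside the last block. [cite: Rogawski1990, §1.10] -/
theorem blockDiagMatrix_apply_hiIndex_of_lt (hc : 2 * c ≤ N) (A : Matrix (Fin c) (Fin c) K)
    (B : Matrix (Fin (N - 2 * c)) (Fin (N - 2 * c)) K) (D : Matrix (Fin c) (Fin c) K) (j : Fin c) {k : Fin N}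
    (hk : (k : ℕ) + c < N) : blockDiagMatrix hc A B D k (hiIndex hc j) = 0 :=
  blockDiagMatrix_apply_of_ne hc A B D (by
    rw [blockLabel_hiIndex hc]; exact fun h => by have := (blockLabel_eq_two_iff hc k).1 h; omega)

/-- `loBlock (diag(A, B, D)) = A`. [cite: Rogawski1990, §1.10] -/
@[simp] theorem loBlock_blockDiagMatrix (hc : 2 * c ≤ N) (A : Matrix (Fin c) (Fin c) K)
    (B : Matrix (Fin (N - 2 * c)) (Fin (N - 2 * c)) K) (D : Matrix (Fin c) (Fin c) K) :
    loBlock hc (blockDiagMatrix hc A B D) = A := by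
  ext i j; rw [loBlock_apply, blockDiagMatrix_castLE_castLE]

/-- `midBlock (diag(A, B, D)) = B`. [cite: Rogawski1990, §1.10] -/
@[simp] theorem midBlock_blockDiagMatrix (hc : 2 * c ≤ N) (A : Matrix (Fin c) (Fin c) K)
    (B : Matrix (Fin (N - 2 * c)) (Fin (N - 2 * c)) K) (D : Matrix (Fin c) (Fin c) K) :
    midBlock hc (blockDiagMatrix hc A B D) = B := by
  ext i j; rw [midBlock_apply, blockDiagMatrix_midIndex_midIndex]

/-- The dual block `A† = J σ(A')ᵀ J` (`A'` playing `A⁻¹`): `A†_{ij} = σ(A'_{rev j, rev i})`. [cite: Rogawski1990, §1.9 p. 13] -/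
def dualBlock (σ : K →+* K) (A' : Matrix (Fin c) (Fin c) K) : Matrix (Fin c) (Fin c) K :=
  Matrix.of fun i j => σ (A' (Fin.rev j) (Fin.rev i))

/-- Entries of the dual block. [cite: Rogawski1990, §1.9 p. 13] -/
@[simp] theorem dualBlock_apply (A' : Matrix (Fin c) (Fin c) K) (i j : Fin c) :
    dualBlock σ A' i j = σ (A' (Fin.rev j) (Fin.rev i)) := rfl

/-- Unitarity of `diag(A, B, A†)`, columns of the first block: `∑_k σ(L_{k, a}) L_{rev k, b} = δ_{b, rev a}` for
`a = castLE i` (only first-block `k` contribute, `rev k` lies in the last block, and `A' A = 1`). [cite: Rogawski1990, §1.9–§1.10] -/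
private theorem unitary_sum_castLE (hc : 2 * c ≤ N) {A A' : Matrix (Fin c) (Fin c) K} (hA'A : A' * A = 1)
    (B : Matrix (Fin (N - 2 * c)) (Fin (N - 2 * c)) K) (i : Fin c) (b : Fin N) :
    ∑ k : Fin N, σ (blockDiagMatrix hc A B (dualBlock σ A') k (Fin.castLE (le_of_two_mul_le hc) i)) *
        blockDiagMatrix hc A B (dualBlock σ A') (Fin.rev k) b =
      if b = Fin.rev (Fin.castLE (le_of_two_mul_le hc) i) then 1 else 0 := by
  have hvan : ∀ k : Fin N, c ≤ (k : ℕ) →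
      σ (blockDiagMatrix hc A B (dualBlock σ A') k (Fin.castLE (le_of_two_mul_le hc) i)) *
        blockDiagMatrix hc A B (dualBlock σ A') (Fin.rev k) b = 0 := fun k hk => by
    rw [blockDiagMatrix_apply_castLE_of_le hc _ _ _ i hk, map_zero, zero_mul]
  rw [sum_eq_sum_castLE_of hc _ hvan]
  simp only [blockDiagMatrix_castLE_castLE hc, rev_castLE hc]
  by_cases hb : N ≤ (b : ℕ) + c
  · obtain ⟨j, rfl⟩ : ∃ j, hiIndex hc j = b := ⟨⟨b + c - N, by omega⟩, Fin.ext (by simp; omega)⟩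
    simp only [blockDiagMatrix_hiIndex_hiIndex hc, dualBlock_apply, Fin.rev_rev, (hiIndex_injective hc).eq_iff]
    have hentry : ∑ k, A' (Fin.rev j) k * A k i = if Fin.rev j = i then 1 else 0 := by
      rw [← Matrix.mul_apply, hA'A, Matrix.one_apply]
    rw [show (∑ k : Fin c, σ (A k i) * σ (A' (Fin.rev j) k)) = σ (∑ k, A' (Fin.rev j) k * A k i) by
      rw [map_sum]; exact Finset.sum_congr rfl fun k _ => by rw [map_mul, mul_comm], hentry]
    by_cases h : Fin.rev j = i
    · rw [if_pos h, if_pos (by rw [← h, Fin.rev_rev]), map_one]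
    · rw [if_neg h, if_neg (fun h' => h (by rw [h', Fin.rev_rev])), map_zero]
  · rw [Finset.sum_eq_zero fun k _ => by rw [blockDiagMatrix_hiIndex_apply_of_lt hc _ _ _ _ (show (b : ℕ) + c < N by omega), mul_zero]]
    rw [if_neg]
    rintro rfl
    simp only [coe_hiIndex] at hb
    omega

/-- Unitarity of `diag(A, B, A†)`, columns of the middle block (only middle `k` contribute; `B` is unitary).
[cite: Rogawski1990, §1.9–§1.10] -/
private theorem unitary_sum_midIndex (hc : 2 * c ≤ N) (A A' : Matrix (Fin c) (Fin c) K) {B : Matrix (Fin (N - 2 * c)) (Fin (N - 2 * c)) K}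
    (hB : (B.map σ)ᵀ * (StdForm.antidiagonal (N - 2 * c)).over K * B = (StdForm.antidiagonal (N - 2 * c)).over K)
    (i : Fin (N - 2 * c)) (b : Fin N) :
    ∑ k : Fin N, σ (blockDiagMatrix hc A B (dualBlock σ A') k (midIndex hc i)) *
        blockDiagMatrix hc A B (dualBlock σ A') (Fin.rev k) b =
      if b = Fin.rev (midIndex hc i) then 1 else 0 := by
  have hvan₁ : ∀ k : Fin N, (k : ℕ) < c →
      σ (blockDiagMatrix hc A B (dualBlock σ A') k (midIndex hc i)) * blockDiagMatrix hc A B (dualBlock σ A') (Fin.rev k) b = 0 :=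
    fun k hk => by rw [blockDiagMatrix_apply_midIndex_of hc _ _ _ i (Or.inl hk), map_zero, zero_mul]
  have hvan₂ : ∀ k : Fin N, N ≤ (k : ℕ) + c →
      σ (blockDiagMatrix hc A B (dualBlock σ A') k (midIndex hc i)) * blockDiagMatrix hc A B (dualBlock σ A') (Fin.rev k) b = 0 :=
    fun k hk => by rw [blockDiagMatrix_apply_midIndex_of hc _ _ _ i (Or.inr hk), map_zero, zero_mul]
  rw [sum_eq_sum_midIndex_of hc _ hvan₁ hvan₂]
  simp only [blockDiagMatrix_midIndex_midIndex hc, rev_midIndex hc]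
  by_cases hb : c ≤ (b : ℕ) ∧ (b : ℕ) + c < N
  · obtain ⟨j, rfl⟩ : ∃ j, midIndex hc j = b := ⟨⟨b - c, by omega⟩, Fin.ext (by simp; omega)⟩
    simp only [blockDiagMatrix_midIndex_midIndex hc, (midIndex_injective hc).eq_iff]
    have h := congrFun (congrFun hB i) j
    rw [map_transpose_mul_antidiagonal_mul_apply, antidiagonal_over_apply] at h
    exact h
  · rw [Finset.sum_eq_zero fun k _ => by
      rw [blockDiagMatrix_midIndex_apply_of hc _ _ _ _ (show (b : ℕ) < c ∨ N ≤ (b : ℕ) + c by omega), mul_zero]]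
    rw [if_neg]
    rintro rfl
    simp only [coe_midIndex] at hb
    omega

/-- Unitarity of `diag(A, B, A†)`, columns of the last block (only last-block `k` contribute, `rev k` lies in the first block,
`σ σ = id` and `A' A = 1`). [cite: Rogawski1990, §1.9–§1.10] -/
private theorem unitary_sum_hiIndex (hσ : ∀ x, σ (σ x) = x) (hc : 2 * c ≤ N) {A A' : Matrix (Fin c) (Fin c) K} (hA'A : A' * A = 1)
    (B : Matrix (Fin (N - 2 * c)) (Fin (N - 2 * c)) K) (i : Fin c) (b : Fin N) :
    ∑ k : Fin N, σ (blockDiagMatrix hc A B (dualBlock σ A') k (hiIndex hc i)) *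
        blockDiagMatrix hc A B (dualBlock σ A') (Fin.rev k) b =
      if b = Fin.rev (hiIndex hc i) then 1 else 0 := by
  have hvan : ∀ k : Fin N, (k : ℕ) + c < N →
      σ (blockDiagMatrix hc A B (dualBlock σ A') k (hiIndex hc i)) * blockDiagMatrix hc A B (dualBlock σ A') (Fin.rev k) b = 0 :=
    fun k hk => by rw [blockDiagMatrix_apply_hiIndex_of_lt hc _ _ _ i hk, map_zero, zero_mul]
  rw [sum_eq_sum_hiIndex_of hc _ hvan]
  simp only [blockDiagMatrix_hiIndex_hiIndex hc, dualBlock_apply, hσ, rev_hiIndex hc]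
  by_cases hb : (b : ℕ) < c
  · obtain ⟨j, rfl⟩ : ∃ j, Fin.castLE (le_of_two_mul_le hc) j = b := ⟨⟨b, hb⟩, Fin.ext (by simp)⟩
    simp only [blockDiagMatrix_castLE_castLE hc, (Fin.castLE_injective _).eq_iff]
    have hentry : ∑ k, A' (Fin.rev i) k * A k j = if Fin.rev i = j then 1 else 0 := by
      rw [← Matrix.mul_apply, hA'A, Matrix.one_apply]
    rw [← Equiv.sum_comp Fin.revPerm] at hentry
    simp only [Fin.revPerm_apply] at hentry
    rw [hentry]
    by_cases h : Fin.rev i = j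
    · rw [if_pos h, if_pos h.symm]
    · rw [if_neg h, if_neg (Ne.symm h)]
  · rw [Finset.sum_eq_zero fun k _ => by rw [blockDiagMatrix_castLE_apply_of_le hc _ _ _ _ (show c ≤ (b : ℕ) by omega), mul_zero]]
    rw [if_neg]
    rintro rfl
    have := i.isLt
    simp at hb
    omega

/-- **`diag(A, g', A†)` satisfies the antidiagonal unitarity identity** when `A' A = 1`, `g'` is unitary for the small
antidiagonal form, `A† = J σ(A')ᵀ J`, and `σ` is an involution. [cite: Rogawski1990, §1.9–§1.10] -/
theorem blockDiagMatrix_unitary (hσ : ∀ x, σ (σ x) = x) (hc : 2 * c ≤ N) {A A' : Matrix (Fin c) (Fin c) K}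
    (hA'A : A' * A = 1) {B : Matrix (Fin (N - 2 * c)) (Fin (N - 2 * c)) K}
    (hB : (B.map σ)ᵀ * (StdForm.antidiagonal (N - 2 * c)).over K * B = (StdForm.antidiagonal (N - 2 * c)).over K) :
    ((blockDiagMatrix hc A B (dualBlock σ A')).map σ)ᵀ * (StdForm.antidiagonal N).over K * blockDiagMatrix hc A B (dualBlock σ A') =
      (StdForm.antidiagonal N).over K := by
  ext a b
  rw [map_transpose_mul_antidiagonal_mul_apply, antidiagonal_over_apply]
  obtain ⟨x, rfl⟩ := (blockSum hc).surjective a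
  rcases x with (i | i) | i
  · rw [blockSum_inl_inl]; exact unitary_sum_castLE hc hA'A B i b
  · rw [blockSum_inl_inr]; exact unitary_sum_midIndex hc A A' hB i b
  · rw [blockSum_inr]; exact unitary_sum_hiIndex hσ hc hA'A B i b

/-- `A⁻¹ A = 1` on matrices for `A ∈ GL_c(K)`. [cite: Rogawski1990, §1.10] -/
theorem coe_inv_mul_coe_gl (A : GL (Fin c) K) : ((A⁻¹ : GL (Fin c) K) : Matrix (Fin c) (Fin c) K) * (A : Matrix (Fin c) (Fin c) K) = 1 := by
  rw [← Units.val_mul, inv_mul_cancel, Units.val_one]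

/-- The matrix `diag(A, g', A†)`, `A† = J σ(A⁻¹)ᵀ J`, satisfies the unitarity identity of `U(σ, J₀)`. [cite: Rogawski1990, §1.9–§1.10] -/
theorem blockDiagMatrix_coe_unitary (hσ : ∀ x, σ (σ x) = x) (hc : 2 * c ≤ N) (A : GL (Fin c) K)
    (g : unitaryGroupOfForm σ ((StdForm.antidiagonal (N - 2 * c)).over K)) :
    ((blockDiagMatrix hc (A : Matrix (Fin c) (Fin c) K) ((g : GL (Fin (N - 2 * c)) K) : Matrix _ _ K)
      (dualBlock σ ((A⁻¹ : GL (Fin c) K) : Matrix (Fin c) (Fin c) K))).map σ)ᵀ * (StdForm.antidiagonal N).over K *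
      blockDiagMatrix hc (A : Matrix (Fin c) (Fin c) K) ((g : GL (Fin (N - 2 * c)) K) : Matrix _ _ K)
      (dualBlock σ ((A⁻¹ : GL (Fin c) K) : Matrix (Fin c) (Fin c) K)) = (StdForm.antidiagonal N).over K :=
  blockDiagMatrix_unitary hσ hc (coe_inv_mul_coe_gl A) (mem_unitaryGroupOfForm_iff.1 g.2)

/-- **The block-diagonal lift** `diag(A, g', A†) ∈ U(σ, J₀)` of `A ∈ GL_c(K)` and `g' ∈ U(σ, J₀^{(N-2c)})`.
[cite: Rogawski1990, §1.10] [cite: BruhatTits1972, (4.4.3)] -/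
def blockDiagLift (hσ : ∀ x, σ (σ x) = x) (hc : 2 * c ≤ N) (A : GL (Fin c) K)
    (g : unitaryGroupOfForm σ ((StdForm.antidiagonal (N - 2 * c)).over K)) : unitaryGroupOfForm σ ((StdForm.antidiagonal N).over K) :=
  unitaryOfMatrix _ (blockDiagMatrix_coe_unitary hσ hc A g)

/-- The matrix of the lift. [cite: Rogawski1990, §1.10] -/
@[simp] theorem coe_blockDiagLift (hσ : ∀ x, σ (σ x) = x) (hc : 2 * c ≤ N) (A : GL (Fin c) K)
    (g : unitaryGroupOfForm σ ((StdForm.antidiagonal (N - 2 * c)).over K)) :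
    ((blockDiagLift hσ hc A g : GL (Fin N) K) : Matrix (Fin N) (Fin N) K) =
      blockDiagMatrix hc (A : Matrix (Fin c) (Fin c) K) ((g : GL (Fin (N - 2 * c)) K) : Matrix _ _ K)
        (dualBlock σ ((A⁻¹ : GL (Fin c) K) : Matrix (Fin c) (Fin c) K)) := rfl

/-- The lift lies in the parabolic `Q_c`. [cite: BruhatTits1972, (4.4.3)] -/
theorem blockDiagLift_mem_blockParabolic (hσ : ∀ x, σ (σ x) = x) (hc : 2 * c ≤ N) (A : GL (Fin c) K)
    (g : unitaryGroupOfForm σ ((StdForm.antidiagonal (N - 2 * c)).over K)) : blockDiagLift hσ hc A g ∈ blockParabolic σ N c := by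
  rw [mem_blockParabolic_iff, coe_blockDiagLift]; exact blockTriangular_blockDiagMatrix hc _ _ _

/-- **`loBlockGL (diag(A, g', A†)) = A`.** [cite: Rogawski1990, §1.10] -/
theorem loBlockGL_blockDiagLift (hσ : ∀ x, σ (σ x) = x) (hc : 2 * c ≤ N) (A : GL (Fin c) K)
    (g : unitaryGroupOfForm σ ((StdForm.antidiagonal (N - 2 * c)).over K)) :
    loBlockGL hc ⟨blockDiagLift hσ hc A g, blockDiagLift_mem_blockParabolic hσ hc A g⟩ = A :=
  Units.ext (by rw [coe_loBlockGL]; exact loBlock_blockDiagMatrix hc _ _ _)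

/-- **`midBlockU (diag(A, g', A†)) = g'`.** [cite: Rogawski1990, §1.10] -/
theorem midBlockU_blockDiagLift (hσ : ∀ x, σ (σ x) = x) (hc : 2 * c ≤ N) (A : GL (Fin c) K)
    (g : unitaryGroupOfForm σ ((StdForm.antidiagonal (N - 2 * c)).over K)) :
    midBlockU hc ⟨blockDiagLift hσ hc A g, blockDiagLift_mem_blockParabolic hσ hc A g⟩ = g :=
  Subtype.ext (Units.ext (by rw [coe_midBlockU]; exact midBlock_blockDiagMatrix hc _ _ _))

/-- Diagonal entries of the lift in the first block: `(diag(A, g', A†))_{jj} = A_{jj}`. [cite: Rogawski1990, §1.10] -/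
theorem blockDiagLift_apply_castLE_castLE (hσ : ∀ x, σ (σ x) = x) (hc : 2 * c ≤ N) (A : GL (Fin c) K)
    (g : unitaryGroupOfForm σ ((StdForm.antidiagonal (N - 2 * c)).over K)) (i j : Fin c) :
    ((blockDiagLift hσ hc A g : GL (Fin N) K) : Matrix (Fin N) (Fin N) K) (Fin.castLE (le_of_two_mul_le hc) i)
      (Fin.castLE (le_of_two_mul_le hc) j) = (A : Matrix (Fin c) (Fin c) K) i j := by
  rw [coe_blockDiagLift, blockDiagMatrix_castLE_castLE]

variable [Valued K ℤᵐ⁰]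

/-- **The lift of integral data lies in `K₀`**: if `A`, `A⁻¹` have integral entries and `g' ∈ K₀` then `diag(A, g', A†) ∈ K₀`
(`σ` preserving the valuation). [cite: BruhatTits1972, (4.4.3)] [cite: CartierCorvallis1979, §IV.1] -/
theorem blockDiagLift_mem_unitaryInt (hσ : ∀ x, σ (σ x) = x) (hvσ : ∀ x, Valued.v (σ x) = Valued.v x) (hc : 2 * c ≤ N)
    {A : GL (Fin c) K} (hA : ∀ i j, Valued.v ((A : Matrix (Fin c) (Fin c) K) i j) ≤ 1)
    (hA' : ∀ i j, Valued.v (((A⁻¹ : GL (Fin c) K) : Matrix (Fin c) (Fin c) K) i j) ≤ 1)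
    {g : unitaryGroupOfForm σ ((StdForm.antidiagonal (N - 2 * c)).over K)}
    (hg : g ∈ unitaryInt σ ((StdForm.antidiagonal (N - 2 * c)).over K)) :
    blockDiagLift hσ hc A g ∈ unitaryInt σ ((StdForm.antidiagonal N).over K) := by
  rw [mem_unitaryInt_iff_forall_v_le_one hvσ]
  intro i j
  rw [coe_blockDiagLift]
  by_cases hij : blockLabel N c i = blockLabel N c j
  · obtain ⟨x, rfl⟩ := (blockSum hc).surjective i
    obtain ⟨y, rfl⟩ := (blockSum hc).surjective j
    rcases x with (x | x) | x <;> rcases y with (y | y) | y <;>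
      simp only [blockSum_inl_inl, blockSum_inl_inr, blockSum_inr, blockLabel_castLE hc, blockLabel_midIndex hc, blockLabel_hiIndex hc] at hij ⊢
    all_goals first
      | (rw [blockDiagMatrix_castLE_castLE hc]; exact hA _ _)
      | (rw [blockDiagMatrix_midIndex_midIndex hc]; exact (mem_unitaryInt_iff.1 hg).1 _ _)
      | (rw [blockDiagMatrix_hiIndex_hiIndex hc, dualBlock_apply, hvσ]; exact hA' _ _)
      | exact absurd hij (by decide)
  · rw [blockDiagMatrix_apply_of_ne hc _ _ _ hij, map_zero]; exact zero_le_one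

end Lift

end Literature.NumberTheory.Automorphic.HermitianLattice

end
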